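import Summits.QuantumAdvantage.AdviceFreeQNC0.TwoBlindSpots
import HarnessLib

/-!
# Cell qa-qnc0 (rung F-Q1, route RingFrame, crux α `RingToElim`): TWO BLIND SPOTS, part 3 — the
# forms of planner qa-qnc0-p1's Sketch11 §23.1 / §23.4 (THEOREM-TARGET T8), all `n`

From the core `ringWinU_twoBlind_glue3_le` (`TwoBlindSpots.lean`):

* `ringWinU_twoBlind_le` — √-degree form on `n` bits: a block `[p, p + M)` (`M ≥ n₀`), two distinct
  bit positions `i, j` outside it not read by the cuts strictly inside the block (flip form),
  degree `≤ c₁√M` ⇒ `#WIN ≤ θ·2ⁿ`, every charge;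
* `ringWinU_twoBlind_polylog_le` — the same at degree `(log₂ n)^C` with `M ≥ (log₂ n)^{2C+1}`;
* the Sketch11 statements VERBATIM and their proofs: `twoBlindSpotsT : TwoBlindSpotsT` (scattered
  blind set `T`, `|T| ≥ 2`), `twoBlindSpots : TwoBlindSpots` (blind pair inside a block `x` to the
  LEFT of `z`), `twoBlindSpotsRight : TwoBlindSpotsRight` (to the RIGHT),
  `twoBlindSpotsImpliesCrossFree : TwoBlindSpotsImpliesCrossFree` (T8 ⇒ the cross-free window
  theorem's conclusion with its `x`-side hypothesis dropped);
* `Reads`, `TotallySighted` (Sketch11 §23.4 verbatim) and `ringWinU_le_of_not_totallySighted` —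
  a strategy that is NOT `(log₂ n)^{2C+1}`-totally sighted is beaten; the by-name reduction
  `α ⟸ totally-sighted-hard` is `Theorems/RingFrameRingToElimOfTotallySighted.lean`.

(The √-form in nested-`glue3` shape, `TwoBlindSpotsSqrt`, is `TwoBlindSpotsSqrt.lean`.)
The cell's theorems (planner qa-qnc0-p1 gen 11, prover qa-qnc0-prover gen 6, 2026-08-27); not in
print.  WHAT THIS IS NOT: nothing on totally sighted strategies (α proper); no separation.

## References

* S. Srinivasan, *A robust version of Hegedűs's lemma, with applications*, TheoretiCS 2 (2023),
  Lemma 3.1 [Srinivasan2023] (through `ringWinU_twoBlind_glue3_le`).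
-/

noncomputable section

namespace Summit.QuantumAdvantage.AdviceFreeQNC0

open Finset
open Literature.Computability.MetaComplexity Literature.Computability.MetaComplexity.Smolensky

/-! ### The √-form and the polylog form on `n` bits (flip hypotheses) -/

/-- **TWO BLIND SPOTS, √-degree form.**  There are `θ < 1`, `c₁ > 0`, `n₀` such that for all
`n`, every block `[p, p + M)` of `M ≥ n₀` input bits, every degree `D ≤ c₁√M`, all distinct bit
positions `i, j` outside the block, every charge and every walk strategy of degree `≤ D` whose cuts
strictly inside the block do not read `u_i` nor `u_j`: `#WIN ≤ θ·2ⁿ`. [cite: Srinivasan2023, Lemma 3.1] -/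
theorem ringWinU_twoBlind_le :
    ∃ θ : ℝ, θ < 1 ∧ ∃ c₁ : ℝ, 0 < c₁ ∧ ∃ n₀ : ℕ, ∀ n p M : ℕ, p + M ≤ n → n₀ ≤ M →
      ∀ D : ℕ, (D : ℝ) ≤ c₁ * Real.sqrt M →
      ∀ i j : Fin n, i ≠ j → ¬ (p ≤ i.val ∧ i.val < p + M) → ¬ (p ≤ j.val ∧ j.val < p + M) →
      ∀ (c : ℕ) (y : Fin (n + 1) → (Fin n → Bool) → Bool), (∀ g, HasDeg (y g) D) →
        (∀ g : Fin (n + 1), p < g.val → g.val < p + M →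
          ∀ u, y g (Function.update u i (!u i)) = y g u) →
        (∀ g : Fin (n + 1), p < g.val → g.val < p + M →
          ∀ u, y g (Function.update u j (!u j)) = y g u) →
        ((univ.filter fun u : Fin n → Bool => ringWinU c y u = true).card : ℝ) ≤ θ * (2 : ℝ) ^ n := by
  obtain ⟨θ, hθ, c₁, hc₁, n₀, H⟩ := ringWinU_twoBlind_glue3_le
  refine ⟨θ, hθ, c₁, hc₁, n₀, ?_⟩
  intro n p M hpM hM D hD i j hij hi hj c y hdeg hI hJ
  obtain ⟨q, rfl⟩ : ∃ q, n = p + M + q := ⟨n - (p + M), by omega⟩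
  exact H p M q hM D hD i j hij (by omega) (by omega) c y hdeg hI hJ

/-- Degree bookkeeping: `k^C ≤ c₁·√L` once `c₁·√k ≥ 1` and `L ≥ k^{2C+1}` (cell lemma, repeated from
`CrossFreeWindowPolylog.lean`). -/
private theorem pow_le_mul_sqrt₂ {c₁ : ℝ} (hc₁ : 0 < c₁) {k C L : ℕ} (hck : 1 ≤ c₁ * Real.sqrt k)
    (hL : k ^ (2 * C + 1) ≤ L) : ((k ^ C : ℕ) : ℝ) ≤ c₁ * Real.sqrt L := by
  have hsqrt : (k : ℝ) ^ C * Real.sqrt k ≤ Real.sqrt L := by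
    have h2 : ((k ^ (2 * C + 1) : ℕ) : ℝ) ≤ L := by exact_mod_cast hL
    have h1 : ((k : ℝ) ^ C) ^ 2 * k ≤ L := by
      calc ((k : ℝ) ^ C) ^ 2 * k = (k : ℝ) ^ (2 * C + 1) := by ring
        _ ≤ L := by push_cast at h2; exact h2
    calc (k : ℝ) ^ C * Real.sqrt k = Real.sqrt (((k : ℝ) ^ C) ^ 2 * k) := by
          rw [Real.sqrt_mul (by positivity), Real.sqrt_sq (by positivity)]
      _ ≤ Real.sqrt L := Real.sqrt_le_sqrt h1
  push_cast
  calc (k : ℝ) ^ C = (k : ℝ) ^ C * 1 := (mul_one _).symm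
    _ ≤ (k : ℝ) ^ C * (c₁ * Real.sqrt k) := mul_le_mul_of_nonneg_left hck (by positivity)
    _ = c₁ * ((k : ℝ) ^ C * Real.sqrt k) := by ring
    _ ≤ c₁ * Real.sqrt L := mul_le_mul_of_nonneg_left hsqrt hc₁.le

/-- `c₁ √k ≥ 1` once `k ≥ ⌈1/c₁²⌉ + 1` (cell lemma, repeated from `CrossFreeWindowPolylog.lean`). -/
private theorem one_le_mul_sqrt₂ {c₁ : ℝ} (hc₁ : 0 < c₁) {k : ℕ} (hk : ⌈1 / c₁ ^ 2⌉₊ + 1 ≤ k) :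
    1 ≤ c₁ * Real.sqrt k := by
  have h2 : ((⌈1 / c₁ ^ 2⌉₊ : ℕ) : ℝ) + 1 ≤ k := by exact_mod_cast hk
  have h3 : (1 / c₁ ^ 2 : ℝ) ≤ ((⌈1 / c₁ ^ 2⌉₊ : ℕ) : ℝ) := Nat.le_ceil _
  have h1 : (1 / c₁ ^ 2 : ℝ) ≤ k := by linarith
  rw [div_le_iff₀ (by positivity)] at h1
  calc (1 : ℝ) = Real.sqrt 1 := Real.sqrt_one.symm
    _ ≤ Real.sqrt (c₁ ^ 2 * k) := Real.sqrt_le_sqrt (by linarith)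
    _ = c₁ * Real.sqrt k := by rw [Real.sqrt_mul (by positivity), Real.sqrt_sq hc₁.le]

/-- **TWO BLIND SPOTS, polylog form.**  There is `θ < 1` such that for every `C` and all large `n`:
a walk strategy of degree `≤ (log₂ n)^C` with a block `[p, p + M)`, `M ≥ (log₂ n)^{2C+1}`, whose
interior cuts do not read two distinct outside bits `u_i, u_j`, wins on at most `θ·2ⁿ` inputs,
every charge. [cite: Srinivasan2023, Lemma 3.1] -/
theorem ringWinU_twoBlind_polylog_le :
    ∃ θ : ℝ, θ < 1 ∧ ∀ C : ℕ, ∃ n₀ : ℕ, ∀ n ≥ n₀, ∀ p M : ℕ, p + M ≤ n →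
      (Nat.log 2 n) ^ (2 * C + 1) ≤ M →
      ∀ i j : Fin n, i ≠ j → ¬ (p ≤ i.val ∧ i.val < p + M) → ¬ (p ≤ j.val ∧ j.val < p + M) →
      ∀ (c : ℕ) (y : Fin (n + 1) → (Fin n → Bool) → Bool),
        (∀ g, HasDeg (y g) ((Nat.log 2 n) ^ C)) →
        (∀ g : Fin (n + 1), p < g.val → g.val < p + M →
          ∀ u, y g (Function.update u i (!u i)) = y g u) →
        (∀ g : Fin (n + 1), p < g.val → g.val < p + M →
          ∀ u, y g (Function.update u j (!u j)) = y g u) →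
        ((univ.filter fun u : Fin n → Bool => ringWinU c y u = true).card : ℝ) ≤ θ * (2 : ℝ) ^ n := by
  obtain ⟨θ, hθ, c₁, hc₁, ℓ₀, Hsq⟩ := ringWinU_twoBlind_le
  refine ⟨θ, hθ, fun C => ⟨2 ^ (max (ℓ₀ + 1) (⌈1 / c₁ ^ 2⌉₊ + 1)), ?_⟩⟩
  intro n hn p M hpM hM i j hij hi hj c y hdeg hI hJ
  set k := Nat.log 2 n with hk
  have hm : max (ℓ₀ + 1) (⌈1 / c₁ ^ 2⌉₊ + 1) ≤ k := Nat.le_log_of_pow_le one_lt_two hn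
  have hkℓ : ℓ₀ + 1 ≤ k := le_trans (le_max_left _ _) hm
  have hk1 : ⌈1 / c₁ ^ 2⌉₊ + 1 ≤ k := le_trans (le_max_right _ _) hm
  have hkk : k ≤ k ^ (2 * C + 1) := Nat.le_self_pow (by omega) k
  have hℓ₀M : ℓ₀ ≤ M := by omega
  have hD := pow_le_mul_sqrt₂ (C := C) hc₁ (one_le_mul_sqrt₂ hc₁ hk1) hM
  exact Hsq n p M hpM hℓ₀M _ hD i j hij hi hj c y hdeg hI hJ

/-! ### Sketch11 §23.1: the statements, verbatim -/

/-- **T8, polylog form** (shape of `ringWinU_crossFree_le` without `hX`, with `2 ≤ L`): window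
`[p, p+L) ++ [p+L, p+L+H) ++ [p+L+H, p+L+H+M)`; the cuts strictly inside the third block do not read
the first.  (Planner qa-qnc0-p1 gen 11, Sketch11 §23.1, verbatim.) -/
def TwoBlindSpots : Prop :=
  ∃ θ : ℝ, θ < 1 ∧ ∀ C : ℕ, ∃ n₀ : ℕ, ∀ n ≥ n₀, ∀ p L H M : ℕ, p + (L + H + M) ≤ n →
    2 ≤ L → (Nat.log 2 n) ^ (2 * C + 1) ≤ M →
    ∀ c : ℕ, ∀ y : Fin (n + 1) → (Fin n → Bool) → Bool,
      (∀ g, HasDeg (y g) ((Nat.log 2 n) ^ C)) →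
      (∀ g : Fin (n + 1), p + (L + H) < g.val → g.val < p + (L + H + M) → ∀ u u' : Fin n → Bool,
        (∀ i : Fin n, ¬ (p ≤ i.val ∧ i.val < p + L) → u i = u' i) → y g u = y g u') →
      ((univ.filter fun u : Fin n → Bool => ringWinU c y u = true).card : ℝ) ≤ θ * (2 : ℝ) ^ n

/-- **T8, reflected** (the blind pair to the RIGHT of the block): window `z(M) ++ h(H) ++ x(L)` at `p`;
the cuts strictly inside `z` do not read `x`.  (Sketch11 §23.1, verbatim.) -/
def TwoBlindSpotsRight : Prop :=
  ∃ θ : ℝ, θ < 1 ∧ ∀ C : ℕ, ∃ n₀ : ℕ, ∀ n ≥ n₀, ∀ p L H M : ℕ, p + (M + H + L) ≤ n →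
    2 ≤ L → (Nat.log 2 n) ^ (2 * C + 1) ≤ M →
    ∀ c : ℕ, ∀ y : Fin (n + 1) → (Fin n → Bool) → Bool,
      (∀ g, HasDeg (y g) ((Nat.log 2 n) ^ C)) →
      (∀ g : Fin (n + 1), p < g.val → g.val < p + M → ∀ u u' : Fin n → Bool,
        (∀ i : Fin n, ¬ (p + (M + H) ≤ i.val ∧ i.val < p + (M + H + L)) → u i = u' i) →
          y g u = y g u') →
      ((univ.filter fun u : Fin n → Bool => ringWinU c y u = true).card : ℝ) ≤ θ * (2 : ℝ) ^ n

/-- **T8, scattered blind set** (the general statement): a block `[p, p+M)` of input bits and a set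
`T` of at least two bit positions outside it (anywhere, on either side) such that no cut strictly
inside the block reads a bit of `T`.  (Sketch11 §23.1, verbatim.) -/
def TwoBlindSpotsT : Prop :=
  ∃ θ : ℝ, θ < 1 ∧ ∀ C : ℕ, ∃ n₀ : ℕ, ∀ n ≥ n₀, ∀ p M : ℕ, p + M ≤ n →
    (Nat.log 2 n) ^ (2 * C + 1) ≤ M → ∀ T : Finset (Fin n), 2 ≤ T.card →
    (∀ i ∈ T, ¬ (p ≤ i.val ∧ i.val < p + M)) →
    ∀ c : ℕ, ∀ y : Fin (n + 1) → (Fin n → Bool) → Bool,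
      (∀ g, HasDeg (y g) ((Nat.log 2 n) ^ C)) →
      (∀ g : Fin (n + 1), p < g.val → g.val < p + M → ∀ u u' : Fin n → Bool,
        (∀ i : Fin n, i ∉ T → u i = u' i) → y g u = y g u') →
      ((univ.filter fun u : Fin n → Bool => ringWinU c y u = true).card : ℝ) ≤ θ * (2 : ℝ) ^ n

/-- T8 ⇒ the cross-free window theorem's conclusion (`ringWinU_crossFree_le`) from its `z`-side
hypothesis alone.  (Sketch11 §23.6, verbatim.) -/
def TwoBlindSpotsImpliesCrossFree : Prop :=
  TwoBlindSpots →
  ∃ θ : ℝ, θ < 1 ∧ ∀ C : ℕ, ∃ n₀ : ℕ, ∀ n ≥ n₀, ∀ p L H M : ℕ, p + (L + H + M) ≤ n →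
    (Nat.log 2 n) ^ (2 * C + 1) ≤ L → (Nat.log 2 n) ^ (2 * C + 1) ≤ M →
    ∀ c : ℕ, ∀ y : Fin (n + 1) → (Fin n → Bool) → Bool,
      (∀ g, HasDeg (y g) ((Nat.log 2 n) ^ C)) →
      (∀ g : Fin (n + 1), p + (L + H) < g.val → g.val < p + (L + H + M) → ∀ u u' : Fin n → Bool,
        (∀ i : Fin n, ¬ (p ≤ i.val ∧ i.val < p + L) → u i = u' i) → y g u = y g u') →
      ((univ.filter fun u : Fin n → Bool => ringWinU c y u = true).card : ℝ) ≤ θ * (2 : ℝ) ^ n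

/-! ### Sketch11 §23.1: the proofs -/

/-- A selector taking equal values on inputs that agree off `T` does not notice the flip of a bit
of `T`. -/
private theorem update_blind_of_T {n : ℕ} {T : Finset (Fin n)} {f : (Fin n → Bool) → Bool}
    (hf : ∀ u u' : Fin n → Bool, (∀ k : Fin n, k ∉ T → u k = u' k) → f u = f u') {i : Fin n}
    (hi : i ∈ T) (u : Fin n → Bool) : f (Function.update u i (!u i)) = f u :=
  hf _ _ fun k hk => Function.update_of_ne (fun h : k = i => hk (by rw [h]; exact hi)) _ _

/-- **T8, scattered blind set — PROVED.** [cite: Srinivasan2023, Lemma 3.1] -/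
theorem twoBlindSpotsT : TwoBlindSpotsT := by
  obtain ⟨θ, hθ, Hpoly⟩ := ringWinU_twoBlind_polylog_le
  refine ⟨θ, hθ, fun C => ?_⟩
  obtain ⟨n₀, hn₀⟩ := Hpoly C
  refine ⟨n₀, fun n hn p M hpM hM T hT hTout c y hdeg hblind => ?_⟩
  obtain ⟨i, hi, j, hj, hij⟩ := Finset.one_lt_card.1 (by omega : 1 < T.card)
  exact hn₀ n hn p M hpM hM i j hij (hTout i hi) (hTout j hj) c y hdeg
    (fun g h1 h2 u => update_blind_of_T (hblind g h1 h2) hi u)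
    (fun g h1 h2 u => update_blind_of_T (hblind g h1 h2) hj u)

/-- **T8, polylog form (blind pair to the left) — PROVED**: `T = {p, p + 1} ⊆ [p, p + L)`.
[cite: Srinivasan2023, Lemma 3.1] -/
theorem twoBlindSpots : TwoBlindSpots := by
  obtain ⟨θ, hθ, HT⟩ := twoBlindSpotsT
  refine ⟨θ, hθ, fun C => ?_⟩
  obtain ⟨n₀, hn₀⟩ := HT C
  refine ⟨n₀, fun n hn p L H M hpn hL hM c y hdeg hblind => ?_⟩
  have hp1 : p + 1 < n := by omega
  let i : Fin n := ⟨p, by omega⟩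
  let j : Fin n := ⟨p + 1, hp1⟩
  have hij : i ≠ j := fun h => by
    have := congrArg Fin.val h
    simp only [i, j] at this
    omega
  have hcard : 2 ≤ ({i, j} : Finset (Fin n)).card := by
    rw [Finset.card_pair hij]
  refine hn₀ n hn (p + (L + H)) M (by omega) hM {i, j} hcard ?_ c y hdeg ?_
  · intro k hk
    simp only [Finset.mem_insert, Finset.mem_singleton] at hk
    rcases hk with rfl | rfl
    · simp only [i]; omega
    · simp only [j]; omega
  · intro g h1 h2 u u' huu'
    refine hblind g h1 (by omega) u u' fun k hk => huu' k fun hkT => ?_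
    simp only [Finset.mem_insert, Finset.mem_singleton] at hkT
    rcases hkT with rfl | rfl
    · simp only [i] at hk; omega
    · simp only [j] at hk; omega

/-- **T8, reflected form (blind pair to the right) — PROVED**:
`T = {p + M + H, p + M + H + 1} ⊆ [p + M + H, p + M + H + L)`. [cite: Srinivasan2023, Lemma 3.1] -/
theorem twoBlindSpotsRight : TwoBlindSpotsRight := by
  obtain ⟨θ, hθ, HT⟩ := twoBlindSpotsT
  refine ⟨θ, hθ, fun C => ?_⟩
  obtain ⟨n₀, hn₀⟩ := HT C
  refine ⟨n₀, fun n hn p L H M hpn hL hM c y hdeg hblind => ?_⟩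
  have hp1 : p + (M + H) + 1 < n := by omega
  let i : Fin n := ⟨p + (M + H), by omega⟩
  let j : Fin n := ⟨p + (M + H) + 1, hp1⟩
  have hij : i ≠ j := fun h => by
    have := congrArg Fin.val h
    simp only [i, j] at this
    omega
  have hcard : 2 ≤ ({i, j} : Finset (Fin n)).card := by
    rw [Finset.card_pair hij]
  refine hn₀ n hn p M (by omega) hM {i, j} hcard ?_ c y hdeg ?_
  · intro k hk
    simp only [Finset.mem_insert, Finset.mem_singleton] at hk
    rcases hk with rfl | rfl
    · simp only [i]; omega
    · simp only [j]; omega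
  · intro g h1 h2 u u' huu'
    refine hblind g h1 h2 u u' fun k hk => huu' k fun hkT => ?_
    simp only [Finset.mem_insert, Finset.mem_singleton] at hkT
    rcases hkT with rfl | rfl
    · simp only [i] at hk; omega
    · simp only [j] at hk; omega

/-- **T8 ⇒ the cross-free window bound without its `x`-side hypothesis — PROVED** (so T8 strictly
contains `ringWinU_crossFree_le`, hence the blind-window and local-rules theorems). -/
theorem twoBlindSpotsImpliesCrossFree : TwoBlindSpotsImpliesCrossFree := by
  rintro ⟨θ, hθ, H⟩
  refine ⟨θ, hθ, fun C => ?_⟩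
  obtain ⟨n₀, hn₀⟩ := H C
  refine ⟨max n₀ 4, fun n hn p L H M hpn hL hM c y hdeg hblind => ?_⟩
  have hn₀n : n₀ ≤ n := le_trans (le_max_left _ _) hn
  have h4 : 4 ≤ n := le_trans (le_max_right _ _) hn
  have hk2 : 2 ≤ Nat.log 2 n := Nat.le_log_of_pow_le one_lt_two (by simpa using h4)
  have hL2 : 2 ≤ L :=
    le_trans hk2 (le_trans (Nat.le_self_pow (by omega) (Nat.log 2 n)) hL)
  exact hn₀ n hn₀n p L H M hpn hL2 hM c y hdeg hblind

/-! ### Sketch11 §23.4: totally sighted strategies -/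

/-- Selector `f` READS bit `i`: flipping `i` changes `f` somewhere.  (Sketch11 §23.4, verbatim.) -/
def Reads {n : ℕ} (f : (Fin n → Bool) → Bool) (i : Fin n) : Prop :=
  ∃ u : Fin n → Bool, f u ≠ f (Function.update u i (!u i))

/-- `y` is `M`-TOTALLY SIGHTED: for every block of `M` input bits and every two distinct bit
positions outside it, some cut strictly inside the block reads one of the two.
(Sketch11 §23.4, verbatim.) -/
def TotallySighted {n : ℕ} (M : ℕ) (y : Fin (n + 1) → (Fin n → Bool) → Bool) : Prop :=
  ∀ p : ℕ, p + M ≤ n → ∀ i j : Fin n, i ≠ j →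
    ¬ (p ≤ i.val ∧ i.val < p + M) → ¬ (p ≤ j.val ∧ j.val < p + M) →
    ∃ g : Fin (n + 1), p < g.val ∧ g.val < p + M ∧ (Reads (y g) i ∨ Reads (y g) j)

/-- **A strategy that is NOT `(log₂ n)^{2C+1}`-totally sighted is beaten**: there is `θ < 1` such
that for every `C` and all large `n`, every walk strategy of degree `≤ (log₂ n)^C` that is not
`(log₂ n)^{2C+1}`-totally sighted wins on at most `θ·2ⁿ` inputs, every charge (its witness block
has two blind outside bits). [cite: Srinivasan2023, Lemma 3.1] -/
theorem ringWinU_le_of_not_totallySighted :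
    ∃ θ : ℝ, θ < 1 ∧ ∀ C : ℕ, ∃ n₀ : ℕ, ∀ n ≥ n₀,
      ∀ (c : ℕ) (y : Fin (n + 1) → (Fin n → Bool) → Bool),
        (∀ g, HasDeg (y g) ((Nat.log 2 n) ^ C)) →
        ¬ TotallySighted ((Nat.log 2 n) ^ (2 * C + 1)) y →
        ((univ.filter fun u : Fin n → Bool => ringWinU c y u = true).card : ℝ) ≤ θ * (2 : ℝ) ^ n := by
  obtain ⟨θ, hθ, Hpoly⟩ := ringWinU_twoBlind_polylog_le
  refine ⟨θ, hθ, fun C => ?_⟩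
  obtain ⟨n₀, hn₀⟩ := Hpoly C
  refine ⟨n₀, fun n hn c y hdeg hnot => ?_⟩
  unfold TotallySighted at hnot
  push Not at hnot
  obtain ⟨p, hpM, i, j, hij, hi, hj, hblind⟩ := hnot
  refine hn₀ n hn p _ hpM le_rfl i j hij (fun h => by have := hi h.1; omega)
    (fun h => by have := hj h.1; omega) c y hdeg ?_ ?_
  · intro g h1 h2 u
    have h := (hblind g h1 h2).1
    unfold Reads at h
    push Not at h
    exact (h u).symm
  · intro g h1 h2 u
    have h := (hblind g h1 h2).2
    unfold Reads at h
    push Not at h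
    exact (h u).symm

end Summit.QuantumAdvantage.AdviceFreeQNC0

end
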